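import Summits.Ventures.CertifiedManyBodySolver.Theorems.M3x2EdgeSplitSymReplayPackedCollectT
import Summits.Ventures.CertifiedManyBodySolver.Theorems.M3x2EdgeSplitSymReplayOutRoutePF
import Mathlib.Algebra.BigOperators.Group.Finset.Piecewise
import HarnessLib

/-!
# SymReplay — COLLECT-LEVEL CONGRUENCE of the packed pipe: equal word sums in ⇒ identical pipe out

(team lb-sym, cell hub-lb; hub-lb-sym-eng-4 g3, 2026-08-28; ADDITIVE on `…PackedCollect` (word sums `csum`, collected forms) and
`…PackedCollectT`/`…OutRoutePF`; nothing landed is touched.)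

WHAT.  The bridges of record swap enumerators by LIST equality (`shareRFastMF*_eq`) or by permutation (`…_perm`).  This module
proves the weaker, purely coefficient-level congruence the packed pipe actually respects:
* `pdropZeros (pcollect2 q)` is the UNIQUE strictly sorted list with nonzero coefficients and `q`'s word sums, hence
  **`pdropZeros_pcollect2_congr : (∀ w, csum q₁ w = csum q₂ w) → pdropZeros (pcollect2 q₁) = pdropZeros (pcollect2 q₂)`**;
* word sums after normal ordering depend only on word sums before (`csum_pnfPoly_congr`, a regrouping over a `Finset` of words);
* therefore **`pcanonNFZHBZ_congr : (∀ w, csum p₁ w = csum p₂ w) → pcanonNFZHBZ lo hi oP p₁ = pcanonNFZHBZ lo hi oP p₂`** (the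
  whole hinted packed pipe, any oracle) and the fact transport **`outFactsP0_of_csum_congr`**: `OutFactsP0` facts evaluated on ANY
  share family `S'` whose packed shares have the word sums of `S`'s packed shares ARE `OutFactsP0` facts for `S` — an enumerator
  may regroup, reorder, split or merge terms freely (η-class levers, merge-based normal ordering) and still feed `…PMF0`-shape
  closings, with ONE obligation: equal packed word sums.
Std axioms; no `native_decide`.

HONEST FRAMING: list/coefficient theory about existing executables; certifies nothing; no bound of record moves; no summit or
crux statement is proved here; nothing here predicts superconductivity.
-/

namespace Summit.Ventures.CertifiedManyBodySolver.Theorems.SymReplay.PackedNF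

open Summit.Ventures.CertifiedManyBodySolver.Theorems.SymReplay

/-! ##### (a) the zero-dropped collected form is determined by word sums -/

/-- Dropping zero-coefficient terms does not change word sums. -/
theorem csum_pdropZeros (w : PWord) : ∀ (l : PPoly), csum (pdropZeros l) w = csum l w
  | [] => rfl
  | t :: l => by
    have ih := csum_pdropZeros w l
    unfold pdropZeros at ih ⊢
    rw [List.filter_cons]
    by_cases h0 : t.1 = 0
    · simp only [h0, decide_true, Bool.not_true, Bool.false_eq_true, ↓reduceIte]
      rw [ih, csum_cons, h0]
      split_ifs <;> simp
    · simp only [h0, decide_false, Bool.not_false, ↓reduceIte]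
      rw [csum_cons, csum_cons, ih]

/-- `pdropZeros` keeps only nonzero coefficients. -/
theorem ne_zero_of_mem_pdropZeros {l : PPoly} {t : ℚ × PWord} (h : t ∈ pdropZeros l) : t.1 ≠ 0 := by
  unfold pdropZeros at h
  have := (List.mem_filter.1 h).2
  simpa using this

/-- `pdropZeros` of a strictly sorted list is strictly sorted. -/
theorem strictP_pdropZeros {l : PPoly} (h : StrictP l) : StrictP (pdropZeros l) :=
  List.Pairwise.sublist List.filter_sublist h

/-- In a strictly sorted list with nonzero coefficients, a word occurs iff its word sum is nonzero. -/
theorem occ_iff_csum_ne_zero (l : PPoly) (hs : StrictP l) (hnz : ∀ t ∈ l, t.1 ≠ 0) (w : PWord) :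
    occ l w = true ↔ csum l w ≠ 0 := by
  constructor
  · intro h
    obtain ⟨t, ht, rfl⟩ := (occ_eq_true_iff l w).1 h
    rw [((mem_iff_of_strict l hs t).1 ht).2]
    exact hnz t ht
  · intro h
    cases hocc : occ l w
    · exact absurd (csum_eq_zero_of_occ l w hocc) h
    · rfl

/-- **Uniqueness of zero-dropped collected forms**: strictly sorted, nonzero coefficients, equal word sums ⇒ equal. -/
theorem eq_of_strict_nonzero (l₁ l₂ : PPoly) (h₁ : StrictP l₁) (n₁ : ∀ t ∈ l₁, t.1 ≠ 0) (h₂ : StrictP l₂)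
    (n₂ : ∀ t ∈ l₂, t.1 ≠ 0) (h : ∀ w, csum l₁ w = csum l₂ w) : l₁ = l₂ := by
  haveI : Std.Irrefl (fun a b : ℚ × PWord => pwordLt a.2 b.2 = true) :=
    ⟨fun a h => by rw [pwordLt_irrefl] at h; exact Bool.false_ne_true h⟩
  haveI : Std.Antisymm (fun a b : ℚ × PWord => pwordLt a.2 b.2 = true) :=
    ⟨fun a b h h' => by rw [pwordLt_asymm _ _ h] at h'; exact absurd h' Bool.false_ne_true⟩
  refine List.Pairwise.eq_of_mem_iff h₁ h₂ fun t => ?_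
  rw [mem_iff_of_strict l₁ h₁, mem_iff_of_strict l₂ h₂, occ_iff_csum_ne_zero l₁ h₁ n₁, occ_iff_csum_ne_zero l₂ h₂ n₂, h t.2]

/-- **The zero-dropped collector output is determined by the input's word sums.** -/
theorem pdropZeros_pcollect2_congr {q₁ q₂ : PPoly} (h : ∀ w, csum q₁ w = csum q₂ w) :
    pdropZeros (pcollect2 q₁) = pdropZeros (pcollect2 q₂) :=
  eq_of_strict_nonzero _ _ (strictP_pdropZeros (pcollect2_isColl q₁).1) (fun _ ht => ne_zero_of_mem_pdropZeros ht)
    (strictP_pdropZeros (pcollect2_isColl q₂).1) (fun _ ht => ne_zero_of_mem_pdropZeros ht) fun w => by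
      rw [csum_pdropZeros, csum_pdropZeros, ((pcollect2_isColl q₁).2 w).2, ((pcollect2_isColl q₂).2 w).2, h w]

/-! ##### (b) word sums through normal ordering depend only on word sums -/

/-- Word sum of a concatenation. -/
theorem csum_append (l₁ l₂ : PPoly) (w : PWord) : csum (l₁ ++ l₂) w = csum l₁ w + csum l₂ w := by
  unfold csum; rw [List.filter_append, List.map_append, List.sum_append]

/-- Word sum of a scalar multiple. -/
theorem csum_ppscale (c : ℚ) (w : PWord) : ∀ (l : PPoly), csum (ppscale c l) w = c * csum l w
  | [] => by simp [ppscale, csum]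
  | t :: l => by
    have ih := csum_ppscale c w l
    simp only [ppscale, List.map_cons] at ih ⊢
    rw [csum_cons, csum_cons, ih]
    simp only
    split_ifs <;> ring

/-- Word sum of a `flatMap`: the sum over the source terms. -/
theorem csum_flatMap (f : ℚ × PWord → PPoly) (w : PWord) : ∀ (p : PPoly), csum (p.flatMap f) w = (p.map fun t => csum (f t) w).sum
  | [] => rfl
  | t :: p => by rw [List.flatMap_cons, csum_append, List.map_cons, List.sum_cons, csum_flatMap f w p]

/-- A weighted sum `Σ_t t.1 · g t.2` over the terms is the `Finset` sum `Σ_v csum p v · g v` over any word set containing `p`'s. -/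
theorem wsum_eq_finset_sum (g : PWord → ℚ) : ∀ (p : PPoly) (V : Finset PWord), (∀ t ∈ p, t.2 ∈ V) →
    (p.map fun t => t.1 * g t.2).sum = ∑ v ∈ V, csum p v * g v
  | [], V, _ => by simp [csum]
  | t :: p, V, hV => by
    rw [List.map_cons, List.sum_cons, wsum_eq_finset_sum g p V fun s hs => hV s (List.mem_cons_of_mem _ hs)]
    have ht : t.2 ∈ V := hV t List.mem_cons_self
    have hsplit : ∀ v ∈ V, csum (t :: p) v * g v = (if t.2 = v then t.1 * g v else 0) + csum p v * g v := by
      intro v _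
      rw [csum_cons]
      by_cases h : t.2 = v
      · rw [if_pos ((pwordEq_eq_true_iff _ _).2 h), if_pos h]; ring
      · rw [if_neg (fun h' => h ((pwordEq_eq_true_iff _ _).1 h')), if_neg h]; ring
    rw [Finset.sum_congr rfl hsplit, Finset.sum_add_distrib, Finset.sum_ite_eq V t.2 (fun v => t.1 * g v), if_pos ht]

/-- **Weighted sums depend only on word sums.** -/
theorem wsum_congr (g : PWord → ℚ) (p₁ p₂ : PPoly) (h : ∀ v, csum p₁ v = csum p₂ v) :
    (p₁.map fun t => t.1 * g t.2).sum = (p₂.map fun t => t.1 * g t.2).sum := by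
  classical
  let V : Finset PWord := (p₁.map Prod.snd).toFinset ∪ (p₂.map Prod.snd).toFinset
  rw [wsum_eq_finset_sum g p₁ V (fun t ht => Finset.mem_union_left _ (List.mem_toFinset.2 (List.mem_map.2 ⟨t, ht, rfl⟩))),
    wsum_eq_finset_sum g p₂ V (fun t ht => Finset.mem_union_right _ (List.mem_toFinset.2 (List.mem_map.2 ⟨t, ht, rfl⟩)))]
  exact Finset.sum_congr rfl fun v _ => by rw [h v]

/-- **Word sums after normal ordering depend only on word sums before.** -/
theorem csum_pnfPoly_congr {p₁ p₂ : PPoly} (h : ∀ v, csum p₁ v = csum p₂ v) (w : PWord) :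
    csum (pnfPoly p₁) w = csum (pnfPoly p₂) w := by
  unfold pnfPoly
  rw [csum_flatMap, csum_flatMap]
  have e : ∀ (p : PPoly), (p.map fun t => csum (ppscale t.1 (pnfWord t.2)) w) = p.map fun t => t.1 * csum (pnfWord t.2) w :=
    fun p => List.map_congr_left fun t _ => csum_ppscale t.1 w _
  rw [e, e]
  exact wsum_congr (fun v => csum (pnfWord v) w) p₁ p₂ h

/-! ##### (c) the packed pipe and its facts are congruent for word sums -/

/-- **PIPE CONGRUENCE**: inputs with equal word sums give the IDENTICAL hinted packed pipe output (any box, any oracle). -/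
theorem pcanonNFZHBZ_congr (lo hi : ℤ × ℤ) (oP : PWord → PHint) {p₁ p₂ : PPoly} (h : ∀ v, csum p₁ v = csum p₂ v) :
    pcanonNFZHBZ lo hi oP p₁ = pcanonNFZHBZ lo hi oP p₂ := by
  unfold pcanonNFZHBZ
  rw [pdropZeros_pcollect2_congr (csum_pnfPoly_congr h)]

/-- The same for the ordered-map pipe. -/
theorem pcanonNFZHBZT_congr (lo hi : ℤ × ℤ) (oP : PWord → PHint) {p₁ p₂ : PPoly} (h : ∀ v, csum p₁ v = csum p₂ v) :
    pcanonNFZHBZT lo hi oP p₁ = pcanonNFZHBZT lo hi oP p₂ := by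
  rw [pcanonNFZHBZT_eq, pcanonNFZHBZT_eq, pcanonNFZHBZ_congr lo hi oP h]

/-- **FACT TRANSPORT BY WORD SUMS**: bare packed facts on a share family `S'` whose packed shares have the word sums of `S`'s packed
shares ARE the `OutFactsP0` facts of `S` (for every `…PMF0`-shape closing). -/
theorem outFactsP0_of_csum_congr (lo hi : ℤ × ℤ) (oP : PWord → PHint) {S S' : ℕ → QPoly}
    (h : ∀ m v, csum (encP lo hi (S' m)) v = csum (encP lo hi (S m)) v) :
    ∀ (n i : ℕ), OutFactsP0 lo hi oP S' i n → OutFactsP0 lo hi oP S i n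
  | 0, _, _ => trivial
  | n + 1, i, hf => ⟨by rw [← pcanonNFZHBZ_congr lo hi oP (h i)]; exact hf.1, outFactsP0_of_csum_congr lo hi oP h n (i + 1) hf.2⟩

end Summit.Ventures.CertifiedManyBodySolver.Theorems.SymReplay.PackedNF
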